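import Summits.Ventures.CertifiedManyBodySolver.Observables.SourcedGibbsTrialCapKSpaceRiemannDensity
import HarnessLib

/-!
# The AF–BCS sourced cap in momentum space (XV-f): a generic two-grid bound for momentum sums of functions of the
# band variables `(ε_k, G_k) = (−2(cos k₁ + cos k₂), 2√2h(cos k₁ − cos k₂))`

Cell hubbard-obs (seat hubbard-obs-pin-2). HONEST FRAMING: zero compute; a real-analysis lemma towards the uniform-in-`L`
packaging of the certified AF–BCS cap (`AF-TL-PACKAGING.md`, step 3b). Every momentum sum of the AF cap
`groundEnergy_dWaveSourceTorus_le_AFBCS_kSpace` is `Σ_k φ(ε_k, G_k)` for a closed-form `φ` of the band energy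
`ε_k = torusBand L k` and the gap `G_k = 2√2h·dWaveGap k`; files XV-d/XV-e prove `|φ(ε,G) − φ(ε',G')| ≤ K₀(|ε−ε'| + |G−G'|)`
for the density, moment and energy coefficients. Here: such a `φ` gives a summand that is `K₀(2 + 2√2|h|)`-Lipschitz in
each momentum (`|cos x − cos x'| ≤ |x − x'|`), hence the Davis–Rabinowitz bound and the two-grid bound
`|S_L/L² − S_{L'}/L'²| ≤ 2π·K₀(2 + 2√2|h|)·(1/L + 1/L')` — ONE lemma for all AF integrands (and any future quasi-free
trial family whose symbol is a function of `(ε_k, G_k)`). No number is claimed; not a statement about order.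

* `abs_bandFn_sub_le_fst/snd` — per-momentum Lipschitz constant `K₀(2 + 2√2|h|)`;
* `abs_sum_bandFn_sub_integral_le` — Davis–Rabinowitz for `Σ_k φ(ε_k, G_k)`;
* `abs_bandFn_two_grid_le` — the two-grid bound per site.

References: Davis–Rabinowitz (1984) §2.1 eq. (2.1.6) [DavisRabinowitz1984].
-/

noncomputable section

open Real Finset Literature.MathematicalPhysics.QuantumLattice Literature.Probability.LatticeModels

namespace Summit.Ventures.CertifiedManyBodySolver.Observables

/-! ### §1 Per-momentum Lipschitz constants of a band function -/

/-- A function `φ(ε, G)` with `|φ(ε,G) − φ(ε',G')| ≤ K₀(|ε−ε'| + |G−G'|)` (`K₀ ≥ 0`) composed with the band variables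
`ε = −2(cos x + cos y)`, `G = 2√2h(cos x − cos y)` is `K₀(2 + 2√2|h|)`-Lipschitz in the first momentum.
[cite: DavisRabinowitz1984, §2.1 eq. (2.1.6)] -/
theorem abs_bandFn_sub_le_fst {φ : ℝ → ℝ → ℝ} {K₀ : ℝ} (hK₀ : 0 ≤ K₀)
    (hφ : ∀ ε G ε' G', |φ ε G - φ ε' G'| ≤ K₀ * (|ε - ε'| + |G - G'|)) (h x x' y : ℝ) :
    |φ (-2 * (Real.cos x + Real.cos y)) (2 * Real.sqrt 2 * h * (Real.cos x - Real.cos y)) -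
      φ (-2 * (Real.cos x' + Real.cos y)) (2 * Real.sqrt 2 * h * (Real.cos x' - Real.cos y))| ≤
      K₀ * (2 + 2 * Real.sqrt 2 * |h|) * |x - x'| := by
  refine (hφ _ _ _ _).trans ?_
  have hcos := Real.abs_cos_sub_cos_le x x'
  have e1 : -2 * (Real.cos x + Real.cos y) - -2 * (Real.cos x' + Real.cos y) = -2 * (Real.cos x - Real.cos x') := by ring
  have e2 : 2 * Real.sqrt 2 * h * (Real.cos x - Real.cos y) - 2 * Real.sqrt 2 * h * (Real.cos x' - Real.cos y) =
      (2 * Real.sqrt 2 * h) * (Real.cos x - Real.cos x') := by ring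
  rw [e1, e2, abs_mul, abs_mul, abs_neg, abs_two, show |2 * Real.sqrt 2 * h| = 2 * Real.sqrt 2 * |h| by
    rw [abs_mul, abs_mul, abs_two, abs_of_nonneg (Real.sqrt_nonneg 2)]]
  rw [show 2 * |Real.cos x - Real.cos x'| + 2 * Real.sqrt 2 * |h| * |Real.cos x - Real.cos x'| =
      (2 + 2 * Real.sqrt 2 * |h|) * |Real.cos x - Real.cos x'| by ring, ← mul_assoc]
  exact mul_le_mul_of_nonneg_left hcos (by positivity)

/-- The same in the second momentum. [cite: DavisRabinowitz1984, §2.1 eq. (2.1.6)] -/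
theorem abs_bandFn_sub_le_snd {φ : ℝ → ℝ → ℝ} {K₀ : ℝ} (hK₀ : 0 ≤ K₀)
    (hφ : ∀ ε G ε' G', |φ ε G - φ ε' G'| ≤ K₀ * (|ε - ε'| + |G - G'|)) (h x y y' : ℝ) :
    |φ (-2 * (Real.cos x + Real.cos y)) (2 * Real.sqrt 2 * h * (Real.cos x - Real.cos y)) -
      φ (-2 * (Real.cos x + Real.cos y')) (2 * Real.sqrt 2 * h * (Real.cos x - Real.cos y'))| ≤
      K₀ * (2 + 2 * Real.sqrt 2 * |h|) * |y - y'| := by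
  refine (hφ _ _ _ _).trans ?_
  have hcos := Real.abs_cos_sub_cos_le y y'
  have e1 : -2 * (Real.cos x + Real.cos y) - -2 * (Real.cos x + Real.cos y') = -2 * (Real.cos y - Real.cos y') := by ring
  have e2 : 2 * Real.sqrt 2 * h * (Real.cos x - Real.cos y) - 2 * Real.sqrt 2 * h * (Real.cos x - Real.cos y') =
      -(2 * Real.sqrt 2 * h) * (Real.cos y - Real.cos y') := by ring
  rw [e1, e2, abs_mul, abs_mul, abs_neg, abs_neg, abs_two, show |2 * Real.sqrt 2 * h| = 2 * Real.sqrt 2 * |h| by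
    rw [abs_mul, abs_mul, abs_two, abs_of_nonneg (Real.sqrt_nonneg 2)]]
  rw [show 2 * |Real.cos y - Real.cos y'| + 2 * Real.sqrt 2 * |h| * |Real.cos y - Real.cos y'| =
      (2 + 2 * Real.sqrt 2 * |h|) * |Real.cos y - Real.cos y'| by ring, ← mul_assoc]
  exact mul_le_mul_of_nonneg_left hcos (by positivity)

/-! ### §2 Davis–Rabinowitz and two-grid bounds for band-function sums -/

/-- **Davis–Rabinowitz bound for a band-function momentum sum** (every `L ≥ 1`):
`|Σ_k φ(ε_k, G_k) − L²/(4π²)∫∫φ(ε(x,y), G(x,y))| ≤ 2π·K₀(2 + 2√2|h|)·L`. [cite: DavisRabinowitz1984, §2.1 eq. (2.1.6)] -/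
theorem abs_sum_bandFn_sub_integral_le (L : ℕ) [NeZero L] {φ : ℝ → ℝ → ℝ} {K₀ : ℝ} (hK₀ : 0 ≤ K₀)
    (hφ : ∀ ε G ε' G', |φ ε G - φ ε' G'| ≤ K₀ * (|ε - ε'| + |G - G'|)) (h : ℝ) :
    |(∑ k : TorusSite 2 L, φ (torusBand L k) (2 * Real.sqrt 2 * h * dWaveGap k)) -
      (L : ℝ) ^ 2 / (4 * π ^ 2) * ∫ y in (-π)..π, ∫ x in (-π)..π,
        φ (-2 * (Real.cos x + Real.cos y)) (2 * Real.sqrt 2 * h * (Real.cos x - Real.cos y))| ≤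
      2 * π * (K₀ * (2 + 2 * Real.sqrt 2 * |h|)) * L := by
  have hK : (0 : ℝ) ≤ K₀ * (2 + 2 * Real.sqrt 2 * |h|) := by positivity
  have key := abs_sum_torusSite_two_sub_integral_le
    (f := fun x y => φ (-2 * (Real.cos x + Real.cos y)) (2 * Real.sqrt 2 * h * (Real.cos x - Real.cos y))) hK
    (fun y x => by simp only [Real.cos_add_two_pi])
    (fun x y => by simp only [Real.cos_add_two_pi])
    (fun x x' y => abs_bandFn_sub_le_fst hK₀ hφ h x x' y)
    (fun x y y' => abs_bandFn_sub_le_snd hK₀ hφ h x y y') L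
  have hsum : ∀ k : TorusSite 2 L, φ (torusBand L k) (2 * Real.sqrt 2 * h * dWaveGap k) =
      φ (-2 * (Real.cos (latticeMomentum L k 0) + Real.cos (latticeMomentum L k 1)))
        (2 * Real.sqrt 2 * h * (Real.cos (latticeMomentum L k 0) - Real.cos (latticeMomentum L k 1))) := by
    intro k
    simp only [torusBand, dWaveGap, Fin.sum_univ_two]
  rw [Finset.sum_congr rfl fun k _ => hsum k]
  exact key

/-- **Two momentum grids differ by `O(1/L + 1/L')` per site** for any band-function sum:
`|S_L/L² − S_{L'}/L'²| ≤ 2π·K₀(2 + 2√2|h|)·(1/L + 1/L')`, `S_L = Σ_k φ(ε_k, G_k)`. [cite: DavisRabinowitz1984, §2.1 eq. (2.1.6)] -/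
theorem abs_bandFn_two_grid_le (L L' : ℕ) [NeZero L] [NeZero L'] {φ : ℝ → ℝ → ℝ} {K₀ : ℝ} (hK₀ : 0 ≤ K₀)
    (hφ : ∀ ε G ε' G', |φ ε G - φ ε' G'| ≤ K₀ * (|ε - ε'| + |G - G'|)) (h : ℝ) :
    |(∑ k : TorusSite 2 L, φ (torusBand L k) (2 * Real.sqrt 2 * h * dWaveGap k)) / (L : ℝ) ^ 2 -
      (∑ k : TorusSite 2 L', φ (torusBand L' k) (2 * Real.sqrt 2 * h * dWaveGap k)) / (L' : ℝ) ^ 2| ≤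
      2 * π * (K₀ * (2 + 2 * Real.sqrt 2 * |h|)) * (1 / (L : ℝ) + 1 / (L' : ℝ)) := by
  have hL : (0 : ℝ) < L := Nat.cast_pos.2 (Nat.pos_of_ne_zero (NeZero.ne L))
  have hL' : (0 : ℝ) < L' := Nat.cast_pos.2 (Nat.pos_of_ne_zero (NeZero.ne L'))
  have h1 := abs_sum_bandFn_sub_integral_le L hK₀ hφ h
  have h2 := abs_sum_bandFn_sub_integral_le L' hK₀ hφ h
  set K := 2 * π * (K₀ * (2 + 2 * Real.sqrt 2 * |h|)) with hKdef
  set I := ∫ y in (-π)..π, ∫ x in (-π)..π,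
        φ (-2 * (Real.cos x + Real.cos y)) (2 * Real.sqrt 2 * h * (Real.cos x - Real.cos y)) with hI
  set S := ∑ k : TorusSite 2 L, φ (torusBand L k) (2 * Real.sqrt 2 * h * dWaveGap k) with hS
  set S' := ∑ k : TorusSite 2 L', φ (torusBand L' k) (2 * Real.sqrt 2 * h * dWaveGap k) with hS'
  have h1' : |S / (L : ℝ) ^ 2 - I / (4 * π ^ 2)| ≤ K * (1 / (L : ℝ)) := by
    have hL2 : (0 : ℝ) < (L : ℝ) ^ 2 := by positivity
    have e : S / (L : ℝ) ^ 2 - I / (4 * π ^ 2) = (S - (L : ℝ) ^ 2 / (4 * π ^ 2) * I) / (L : ℝ) ^ 2 := by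
      field_simp
    rw [e, abs_div, abs_of_pos hL2, div_le_iff₀ hL2]
    calc |S - (L : ℝ) ^ 2 / (4 * π ^ 2) * I| ≤ K * L := h1
      _ = K * (1 / (L : ℝ)) * (L : ℝ) ^ 2 := by field_simp
  have h2' : |S' / (L' : ℝ) ^ 2 - I / (4 * π ^ 2)| ≤ K * (1 / (L' : ℝ)) := by
    have hL2 : (0 : ℝ) < (L' : ℝ) ^ 2 := by positivity
    have e : S' / (L' : ℝ) ^ 2 - I / (4 * π ^ 2) = (S' - (L' : ℝ) ^ 2 / (4 * π ^ 2) * I) / (L' : ℝ) ^ 2 := by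
      field_simp
    rw [e, abs_div, abs_of_pos hL2, div_le_iff₀ hL2]
    calc |S' - (L' : ℝ) ^ 2 / (4 * π ^ 2) * I| ≤ K * L' := h2
      _ = K * (1 / (L' : ℝ)) * (L' : ℝ) ^ 2 := by field_simp
  have e3 : S / (L : ℝ) ^ 2 - S' / (L' : ℝ) ^ 2 =
      (S / (L : ℝ) ^ 2 - I / (4 * π ^ 2)) - (S' / (L' : ℝ) ^ 2 - I / (4 * π ^ 2)) := by ring
  rw [e3]
  refine (abs_sub _ _).trans ?_
  rw [mul_add]
  exact add_le_add h1' h2'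

end Summit.Ventures.CertifiedManyBodySolver.Observables
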